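import Literature.MathematicalPhysics.QuantumFieldTheory.Balaban1983to89.B6KernelComposition
import Literature.MathematicalPhysics.QuantumFieldTheory.Balaban1983to89.B12Decay510Torus

/-!
# `T4Continuum.ShellMeasureDecayKernelSums` — WALL §2 (a) item (P4), row S66 file 3a: «DECAY KERNEL ⇒ ROW∕COLUMN
# SUMS» (the linear engine).  Operator-valued kernels on bond fields: the `∞→∞` bound is the ROW sum, the `1→1`
# bound (and the bound along ONE bond direction) is the COLUMN sum, and both MULTIPLY under composition; a kernel
# dominated by `c₀·e^{−δ·ρ}` on an index set PLACED in `ℤᵈ` (sup distance) or in the torus `(ℤ∕Tℤ)ᵈ` (periodic ℓ¹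
# distance), at most `m` indices per site, has row sums `≤ c₀·m·C(δ, d)` and column sums `≤ c₀·m′·C(δ, d)` UNIFORMLY
# IN THE VOLUME — the numbers behind the DECAY BINDERS of the owner's S66 file 2 (`ShellMeasureGradientTailPairing`
# p221557 ∕ `ShellMeasureGradientTailHDLocal`); file 3b (`ShellMeasureDecayKernelBinders`) converts them into file
# 2b's binder shapes (cell `pub-balaban`, sub-cell `t4`, spine estimate NE7c (node U5b); NE7c ROUND-2 crew, unit
# `b2b-balaban-t4-ne7c-formalise-leaf-06` gen 4, owner table `LEAVES-NE7c-P1.md` row S66 f3; imports the tree's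
# lattice-sum engines `B6KernelComposition` (ℤᵈ) and `B12Decay510Torus` (torus) ONLY — no `Summits` import, any
# `RCLike` scalar field; [folklore]; two DATA defs (`kerOp`, `compKer`), 0 `def … : Prop`, 0 sorry)

HONEST FRAMING.  Finite four-torus programme, rung (B)+1 only — NOT infinite volume, NOT a mass gap, NOT the Clay
problem, NOT summit progress; (B), `BetaPertHyp`, (B^μ) are not consumed.  NE7c (`T4IndicatorShell.ShellWeightBound`)
is NOT PRINTED and NOT PROVED; «NE7c ⇐ the named binders».  ELEMENTARY bookkeeping (finite sums, operator norms) on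
OUR side; nothing printed is asserted.  [Balaban1985Variational] (cell paper B11) (73) p. 289 *«|𝔇(A′; c, b)| ≤
O(1)C₃ε₃(Lʲη)^{−d+1}e^{−½δ₀d(c₋,y)}, b ∈ Bʲ(y), y ∈ Λ_j»*, (46) (= [5] Thm 3.12, the deep wall) and [5] (3.132) are
LOCATORS for the SHAPE «kernel entry ≤ prefactor × e^{−δ·distance}» — DISPLAYED binders of the cell (WALL
`t4/b2b-balaban-t4-ne7c-p1/WALL-NE7c-P1.md` §2), not discharged here.  HONEST DEPENDENCY (cell): continuum YM on T⁴ ⇐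
BetaPertH ∧ nine spine estimates (0/9 proved); BetaPertH ⇐ (D1) ∧ (D4) ∧ CAP+tail; G-an2-4 gates asym, D1 and NE2/3/4.

WHY (owner, journal «OWNER INTENT NE7c-S66 f2», 2026-08-20T14:42:56Z).  File 1 `ShellMeasureGradientTailHD`
(p221067) composed the HD-terms of B11 (80) at the POTENTIAL level with operator-norm binders, which are EXTENSIVE on
the sup-normed bond fields of a block (the dual of the sup norm is ℓ¹; one global cubic constant ∝ #plaquettes);
B11's (85)–(89) are PER-BOND bounds with O(1) constants, paid for by KERNEL DECAY.  File 2 (owner) re-does the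
composition over bond fields `Λ → 𝔄` with BOTH the sup norm and the ℓ¹ size `norm₁ A = Σ_b ‖A b‖`, under binders of
ROW-SUM type (`‖M A‖_∞ ≤ m_∞‖A‖²`) and of COLUMN-SUM type along single-bond directions (`‖DM(A)(ι_b X)‖₁ ≤
m₁‖A‖‖X‖`).  THIS FILE supplies the linear engine and the volume-free numbers:
* §1 `kerOp k` — `(𝒦A)(c) = Σ_b k(c, b)(A b)` for `k : Λ′ → Λ → (𝔄 →L 𝔅)` on finite index sets; `norm_kerOp_le`
  (`∞→∞` = max ROW sum), `sum_norm_kerOp_apply_le_of_col` (`1→1` = max COLUMN sum), `sum_norm_kerOp_single_le` (a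
  single-bond direction costs ONE column), `norm_kerOp_apply_le_of_entry` (sup entry × ℓ¹ input); composition
  `compKer`/`kerOp_comp` with `rowSum_compKer_le`/`colSum_compKer_le` — row sums multiply, column sums multiply
  (how a (46)-TYPE `H` and a (73)-TYPE `𝔇` chain).  The ℓ¹ sizes are written as the raw sums `Σ_c ‖· c‖` (any
  scalar field); they ARE the owner's `ShellMeasureGradientTailPairing.norm₁` by `rfl` (file 3b says so in ℂ).
* §2 DECAY ⇒ SUMS for index sets PLACED by `pos : Λ → S`, `S` carrying a distance-like `ρ` with a UNIFORM
  exponential sum `∀ x, Σ_b e^{−δρ(x, pos b)} ≤ M` (for `pos = id` on a `B6.Geometry` this hypothesis IS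
  `B11SectG.RowSum g δ M`, the shape of [3] Lemma 2.1 (2.61)): `rowSum_le_of_decay`, `colSum_le_of_decay`; the fibre
  count `sum_comp_le_card_mul_sum`.
* §3 THE TWO LATTICE ENGINES OF THE TREE BY NAME, volume-uniform for placed index sets: `sum_exp_dist_comp_le` (ℤᵈ,
  sup distance: `≤ m·latticeConst d a = m·(2∕(1 − e^{−a∕d}))ᵈ`, `B6KernelComposition.sum_exp_dist_le`),
  `sum_exp_pl1_comp_le` (torus, periodic ℓ¹: `≤ m·K₁ d a`, `B12Decay510Torus.sum_exp_pl1_le_K₁`; the closed form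
  `K₁ d a ≤ latticeConst d a`, `d ≥ 1`, is `NE9KernelGeometryTorus.K₁_le_c0`, not re-proved); hence
  `rowSum_le_of_decay_torus`∕`colSum_le_of_decay_torus` and the `_lattice` twins — row sums `≤ c₀·m·C`, column sums
  `≤ c₀·m′·C`, NO `#Λ`, NO volume.
NOT HERE: the nonlinear conversion (73)-TYPE ⇒ (55)-TYPE and file 2b's binder shapes (file 3b); the pairing and the
four terms of (80) (file 2); any identification of `k` with Bałaban's `H`, `𝔇`, `Δ_π` ([dict]); (46)∕(73)∕(3.132)
themselves; the multi-scale weights (row S65).  No estimate of Bałaban's is discharged; NOTHING in the countdown moves.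
-/

noncomputable section

open Metric Set

namespace Summit.QuantumFields.BalabanUV.T4Continuum.ShellMeasureDecayKernelSums

open Literature.MathematicalPhysics.QuantumFieldTheory.Balaban1983to89
open B6KernelComposition (latticeConst sum_exp_dist_le)
open B12Decay510Window (K₁)
open TreeLengthTorus (TPt)
open B12Decay510Torus (pl1 pl1_sub_comm sum_exp_pl1_le_K₁)

variable {𝕜 : Type*} [RCLike 𝕜] {Λ Λ' Λ'' : Type*}
variable {𝔄 𝔅 ℭ : Type*} [NormedAddCommGroup 𝔄] [NormedSpace 𝕜 𝔄] [NormedAddCommGroup 𝔅] [NormedSpace 𝕜 𝔅]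
  [NormedAddCommGroup ℭ] [NormedSpace 𝕜 ℭ]

/-! ## §1 Kernel operators on bond fields: row sums give `∞→∞`, column sums give `1→1` -/

/-- THE OPERATOR OF AN OPERATOR-VALUED KERNEL on finite index sets: `(kerOp k A)(c) = Σ_b k c b (A b)` for
`k : Λ′ → Λ → (𝔄 →L[𝕜] 𝔅)` and a bond field `A : Λ → 𝔄`, as a continuous linear map (DATA). [folklore] -/
def kerOp [Fintype Λ] (k : Λ' → Λ → (𝔄 →L[𝕜] 𝔅)) : (Λ → 𝔄) →L[𝕜] (Λ' → 𝔅) :=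
  ContinuousLinearMap.pi fun c => ∑ b, (k c b).comp (ContinuousLinearMap.proj b)

/-- Unfolding: `kerOp k A c = Σ_b k c b (A b)`. [folklore] -/
@[simp] theorem kerOp_apply [Fintype Λ] (k : Λ' → Λ → (𝔄 →L[𝕜] 𝔅)) (A : Λ → 𝔄) (c : Λ') :
    kerOp k A c = ∑ b, k c b (A b) := by
  simp [kerOp]

/-- On a single-bond field `ι_b X = Pi.single b X` the operator reads off the `b`-column. [folklore] -/
theorem kerOp_single [Fintype Λ] [DecidableEq Λ] (k : Λ' → Λ → (𝔄 →L[𝕜] 𝔅)) (b : Λ) (X : 𝔄) (c : Λ') :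
    kerOp k (Pi.single b X) c = k c b X := by
  rw [kerOp_apply, Finset.sum_eq_single b (fun b' _ hb' => by simp [hb']) (by simp)]
  simp

/-- One output component: `‖(kerOp k A) c‖ ≤ (Σ_b ‖k c b‖)·‖A‖_∞` (the `c`-th ROW sum). [folklore] -/
theorem norm_kerOp_apply_le [Fintype Λ] (k : Λ' → Λ → (𝔄 →L[𝕜] 𝔅)) (A : Λ → 𝔄) (c : Λ') :
    ‖kerOp k A c‖ ≤ (∑ b, ‖k c b‖) * ‖A‖ := by
  rw [kerOp_apply, Finset.sum_mul]
  refine (norm_sum_le _ _).trans (Finset.sum_le_sum fun b _ => ?_)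
  exact ((k c b).le_opNorm _).trans (mul_le_mul_of_nonneg_left (norm_le_pi_norm A b) (norm_nonneg _))

/-- One output component against the ℓ¹ size of the input: `‖(kerOp k A) c‖ ≤ κ·Σ_b ‖A b‖` when every entry of the
`c`-th row has `‖k c b‖ ≤ κ`. [folklore] -/
theorem norm_kerOp_apply_le_of_entry [Fintype Λ] (k : Λ' → Λ → (𝔄 →L[𝕜] 𝔅)) {κ : ℝ} (c : Λ')
    (hk : ∀ b, ‖k c b‖ ≤ κ) (A : Λ → 𝔄) : ‖kerOp k A c‖ ≤ κ * ∑ b, ‖A b‖ := by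
  rw [kerOp_apply, Finset.mul_sum]
  refine (norm_sum_le _ _).trans (Finset.sum_le_sum fun b _ => ?_)
  exact ((k c b).le_opNorm _).trans (mul_le_mul_of_nonneg_right (hk b) (norm_nonneg _))

/-- **ROW SUMS GIVE THE `∞→∞` BOUND**: `Σ_b ‖k c b‖ ≤ R` for every `c` ⟹ `‖kerOp k A‖_∞ ≤ R·‖A‖_∞`. [folklore] -/
theorem norm_kerOp_le [Fintype Λ] [Fintype Λ'] (k : Λ' → Λ → (𝔄 →L[𝕜] 𝔅)) {R : ℝ} (hR : 0 ≤ R)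
    (hrow : ∀ c, ∑ b, ‖k c b‖ ≤ R) (A : Λ → 𝔄) : ‖kerOp k A‖ ≤ R * ‖A‖ :=
  (pi_norm_le_iff_of_nonneg (by positivity)).2 fun c =>
    (norm_kerOp_apply_le k A c).trans (mul_le_mul_of_nonneg_right (hrow c) (norm_nonneg _))

/-- … hence the operator norm: `‖kerOp k‖ ≤ R`. [folklore] -/
theorem opNorm_kerOp_le [Fintype Λ] [Fintype Λ'] (k : Λ' → Λ → (𝔄 →L[𝕜] 𝔅)) {R : ℝ} (hR : 0 ≤ R)
    (hrow : ∀ c, ∑ b, ‖k c b‖ ≤ R) : ‖kerOp k‖ ≤ R :=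
  ContinuousLinearMap.opNorm_le_bound _ hR (norm_kerOp_le k hR hrow)

/-- The ℓ¹ size of the output against the column sums: `Σ_c ‖(kerOp k A) c‖ ≤ Σ_b (Σ_c ‖k c b‖)·‖A b‖`. [folklore] -/
theorem sum_norm_kerOp_apply_le [Fintype Λ] [Fintype Λ'] (k : Λ' → Λ → (𝔄 →L[𝕜] 𝔅)) (A : Λ → 𝔄) :
    ∑ c, ‖kerOp k A c‖ ≤ ∑ b, (∑ c, ‖k c b‖) * ‖A b‖ := by
  calc ∑ c, ‖kerOp k A c‖ ≤ ∑ c, ∑ b, ‖k c b‖ * ‖A b‖ := Finset.sum_le_sum fun c _ => by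
        rw [kerOp_apply]
        exact (norm_sum_le _ _).trans (Finset.sum_le_sum fun b _ => (k c b).le_opNorm _)
    _ = ∑ b, (∑ c, ‖k c b‖) * ‖A b‖ := by
        rw [Finset.sum_comm]
        exact Finset.sum_congr rfl fun b _ => by rw [Finset.sum_mul]

/-- **COLUMN SUMS GIVE THE `1→1` BOUND**: `Σ_c ‖k c b‖ ≤ C` (all `b`) ⟹ `Σ_c ‖(kerOp k A) c‖ ≤ C·‖A‖₁`. [folklore] -/
theorem sum_norm_kerOp_apply_le_of_col [Fintype Λ] [Fintype Λ'] (k : Λ' → Λ → (𝔄 →L[𝕜] 𝔅)) {C : ℝ}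
    (hcol : ∀ b, ∑ c, ‖k c b‖ ≤ C) (A : Λ → 𝔄) : ∑ c, ‖kerOp k A c‖ ≤ C * ∑ b, ‖A b‖ := by
  refine (sum_norm_kerOp_apply_le k A).trans ?_
  rw [Finset.mul_sum]
  exact Finset.sum_le_sum fun b _ => mul_le_mul_of_nonneg_right (hcol b) (norm_nonneg _)

/-- **A SINGLE-BOND DIRECTION COSTS ONE COLUMN**: `Σ_c ‖kerOp k (ι_b X) c‖ ≤ (Σ_c ‖k c b‖)·‖X‖`. [folklore] -/
theorem sum_norm_kerOp_single_le [Fintype Λ] [Fintype Λ'] [DecidableEq Λ] (k : Λ' → Λ → (𝔄 →L[𝕜] 𝔅)) (b : Λ)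
    (X : 𝔄) : ∑ c, ‖kerOp k (Pi.single b X) c‖ ≤ (∑ c, ‖k c b‖) * ‖X‖ := by
  simp_rw [kerOp_single]
  rw [Finset.sum_mul]
  exact Finset.sum_le_sum fun c _ => (k c b).le_opNorm X

/-! ### Composition: row sums multiply, column sums multiply -/

/-- The kernel of the composite `kerOp k₁ ∘ kerOp k₂`: `(k₁ ⋆ k₂)(e, b) = Σ_c k₁(e, c) ∘ k₂(c, b)` (DATA). [folklore] -/
def compKer [Fintype Λ'] (k₁ : Λ'' → Λ' → (𝔅 →L[𝕜] ℭ)) (k₂ : Λ' → Λ → (𝔄 →L[𝕜] 𝔅)) :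
    Λ'' → Λ → (𝔄 →L[𝕜] ℭ) :=
  fun e b => ∑ c, (k₁ e c).comp (k₂ c b)

/-- `kerOp k₁ (kerOp k₂ A) = kerOp (compKer k₁ k₂) A`. [folklore] -/
theorem kerOp_comp_apply [Fintype Λ] [Fintype Λ'] (k₁ : Λ'' → Λ' → (𝔅 →L[𝕜] ℭ))
    (k₂ : Λ' → Λ → (𝔄 →L[𝕜] 𝔅)) (A : Λ → 𝔄) : kerOp k₁ (kerOp k₂ A) = kerOp (compKer k₁ k₂) A := by
  funext e
  simp only [kerOp_apply, compKer, map_sum, sum_apply, ContinuousLinearMap.comp_apply]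
  rw [Finset.sum_comm]

/-- … as continuous linear maps: `kerOp k₁ ∘ kerOp k₂ = kerOp (k₁ ⋆ k₂)`. [folklore] -/
theorem kerOp_comp [Fintype Λ] [Fintype Λ'] (k₁ : Λ'' → Λ' → (𝔅 →L[𝕜] ℭ)) (k₂ : Λ' → Λ → (𝔄 →L[𝕜] 𝔅)) :
    (kerOp k₁).comp (kerOp k₂) = kerOp (compKer k₁ k₂) := by
  ext A e
  rw [ContinuousLinearMap.comp_apply, kerOp_comp_apply]

/-- **ROW SUMS MULTIPLY**: `Σ_c ‖k₁ e c‖ ≤ R₁`, `Σ_b ‖k₂ c b‖ ≤ R₂` (`R₂ ≥ 0`) ⟹ `Σ_b ‖(k₁ ⋆ k₂) e b‖ ≤ R₁R₂`.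
[folklore] -/
theorem rowSum_compKer_le [Fintype Λ] [Fintype Λ'] (k₁ : Λ'' → Λ' → (𝔅 →L[𝕜] ℭ)) (k₂ : Λ' → Λ → (𝔄 →L[𝕜] 𝔅))
    {R₁ R₂ : ℝ} (hR₂ : 0 ≤ R₂) (h₁ : ∀ e, ∑ c, ‖k₁ e c‖ ≤ R₁) (h₂ : ∀ c, ∑ b, ‖k₂ c b‖ ≤ R₂) (e : Λ'') :
    ∑ b, ‖compKer k₁ k₂ e b‖ ≤ R₁ * R₂ := by
  calc ∑ b, ‖compKer k₁ k₂ e b‖ ≤ ∑ b, ∑ c, ‖k₁ e c‖ * ‖k₂ c b‖ := Finset.sum_le_sum fun b _ =>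
        (norm_sum_le _ _).trans (Finset.sum_le_sum fun c _ => ContinuousLinearMap.opNorm_comp_le _ _)
    _ = ∑ c, ‖k₁ e c‖ * ∑ b, ‖k₂ c b‖ := by
        rw [Finset.sum_comm]
        exact Finset.sum_congr rfl fun c _ => by rw [Finset.mul_sum]
    _ ≤ ∑ c, ‖k₁ e c‖ * R₂ := Finset.sum_le_sum fun c _ => mul_le_mul_of_nonneg_left (h₂ c) (norm_nonneg _)
    _ = (∑ c, ‖k₁ e c‖) * R₂ := by rw [Finset.sum_mul]
    _ ≤ R₁ * R₂ := mul_le_mul_of_nonneg_right (h₁ e) hR₂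

/-- **COLUMN SUMS MULTIPLY**: `Σ_e ‖k₁ e c‖ ≤ C₁` (`C₁ ≥ 0`), `Σ_c ‖k₂ c b‖ ≤ C₂` ⟹ `Σ_e ‖(k₁ ⋆ k₂) e b‖ ≤ C₁C₂`.
[folklore] -/
theorem colSum_compKer_le [Fintype Λ'] [Fintype Λ''] (k₁ : Λ'' → Λ' → (𝔅 →L[𝕜] ℭ))
    (k₂ : Λ' → Λ → (𝔄 →L[𝕜] 𝔅)) {C₁ C₂ : ℝ} (hC₁ : 0 ≤ C₁) (h₁ : ∀ c, ∑ e, ‖k₁ e c‖ ≤ C₁)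
    (h₂ : ∀ b, ∑ c, ‖k₂ c b‖ ≤ C₂) (b : Λ) : ∑ e, ‖compKer k₁ k₂ e b‖ ≤ C₁ * C₂ := by
  calc ∑ e, ‖compKer k₁ k₂ e b‖ ≤ ∑ e, ∑ c, ‖k₁ e c‖ * ‖k₂ c b‖ := Finset.sum_le_sum fun e _ =>
        (norm_sum_le _ _).trans (Finset.sum_le_sum fun c _ => ContinuousLinearMap.opNorm_comp_le _ _)
    _ = ∑ c, (∑ e, ‖k₁ e c‖) * ‖k₂ c b‖ := by
        rw [Finset.sum_comm]
        exact Finset.sum_congr rfl fun c _ => by rw [Finset.sum_mul]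
    _ ≤ ∑ c, C₁ * ‖k₂ c b‖ := Finset.sum_le_sum fun c _ => mul_le_mul_of_nonneg_right (h₁ c) (norm_nonneg _)
    _ = C₁ * ∑ c, ‖k₂ c b‖ := by rw [Finset.mul_sum]
    _ ≤ C₁ * C₂ := mul_le_mul_of_nonneg_left (h₂ b) hC₁

/-! ## §2 Decay ⇒ row∕column sums, for index sets PLACED in a set with uniform exponential sums -/

section Decay

variable {S : Type*}

/-- **DECAY ⇒ ROW SUMS.**  Index sets placed by `posIn : Λ → S`, `posOut : Λ′ → S`; a kernel dominated by
`c₀·e^{−δ·ρ(posOut c, posIn b)}`; a UNIFORM exponential-sum bound over the INPUT indices, `Σ_b e^{−δρ(x, posIn b)} ≤ M`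
for every `x : S` (for `posIn = id` on the sites of a `B6.Geometry` this is LITERALLY `B11SectG.RowSum g δ M`, the shape
of [3] Lemma 2.1 (2.61)) ⟹ every row sum is `≤ c₀·M`. [folklore] -/
theorem rowSum_le_of_decay [Fintype Λ] (k : Λ' → Λ → (𝔄 →L[𝕜] 𝔅)) (ρ : S → S → ℝ) (posIn : Λ → S)
    (posOut : Λ' → S) {c₀ δ M : ℝ} (hc₀ : 0 ≤ c₀)
    (hk : ∀ c b, ‖k c b‖ ≤ c₀ * Real.exp (-(δ * ρ (posOut c) (posIn b))))
    (hM : ∀ x : S, ∑ b, Real.exp (-(δ * ρ x (posIn b))) ≤ M) (c : Λ') : ∑ b, ‖k c b‖ ≤ c₀ * M :=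
  calc ∑ b, ‖k c b‖ ≤ ∑ b, c₀ * Real.exp (-(δ * ρ (posOut c) (posIn b))) := Finset.sum_le_sum fun b _ => hk c b
    _ = c₀ * ∑ b, Real.exp (-(δ * ρ (posOut c) (posIn b))) := by rw [Finset.mul_sum]
    _ ≤ c₀ * M := mul_le_mul_of_nonneg_left (hM (posOut c)) hc₀

/-- **DECAY ⇒ COLUMN SUMS**, with the uniform exponential sum over the OUTPUT indices `Σ_c e^{−δρ(posOut c, x)} ≤ M′`.
[folklore] -/
theorem colSum_le_of_decay [Fintype Λ'] (k : Λ' → Λ → (𝔄 →L[𝕜] 𝔅)) (ρ : S → S → ℝ) (posIn : Λ → S)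
    (posOut : Λ' → S) {c₀ δ M' : ℝ} (hc₀ : 0 ≤ c₀)
    (hk : ∀ c b, ‖k c b‖ ≤ c₀ * Real.exp (-(δ * ρ (posOut c) (posIn b))))
    (hM' : ∀ x : S, ∑ c, Real.exp (-(δ * ρ (posOut c) x)) ≤ M') (b : Λ) : ∑ c, ‖k c b‖ ≤ c₀ * M' :=
  calc ∑ c, ‖k c b‖ ≤ ∑ c, c₀ * Real.exp (-(δ * ρ (posOut c) (posIn b))) := Finset.sum_le_sum fun c _ => hk c b
    _ = c₀ * ∑ c, Real.exp (-(δ * ρ (posOut c) (posIn b))) := by rw [Finset.mul_sum]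
    _ ≤ c₀ * M' := mul_le_mul_of_nonneg_left (hM' (posIn b)) hc₀

/-- **THE FIBRE COUNT**: at most `m` indices per site (`#{b : pos b = x} ≤ m`), `f ≥ 0`, `T ⊇ pos(Λ)` finite ⟹
`Σ_b f(pos b) ≤ m·Σ_{x ∈ T} f x` (bonds per site: `m = d` on `ℤᵈ`). [folklore] -/
theorem sum_comp_le_card_mul_sum [Fintype Λ] [DecidableEq S] (pos : Λ → S) (T : Finset S) (hT : ∀ b, pos b ∈ T)
    {m : ℕ} (hm : ∀ x, (Finset.univ.filter fun b => pos b = x).card ≤ m) (f : S → ℝ) (hf : ∀ x, 0 ≤ f x) :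
    ∑ b, f (pos b) ≤ m * ∑ x ∈ T, f x := by
  rw [← Finset.sum_fiberwise_of_maps_to (s := Finset.univ) (t := T) (g := pos) (fun b _ => hT b)
    (fun b => f (pos b)), Finset.mul_sum]
  refine Finset.sum_le_sum fun x _ => ?_
  have h : ∑ b ∈ Finset.univ.filter (fun b => pos b = x), f (pos b) =
      ((Finset.univ.filter fun b => pos b = x).card : ℝ) * f x := by
    rw [Finset.sum_congr rfl (g := fun _ => f x) fun b hb => by rw [(Finset.mem_filter.1 hb).2],
      Finset.sum_const, nsmul_eq_mul]
  rw [h]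
  exact mul_le_mul_of_nonneg_right (by exact_mod_cast hm x) (hf x)

end Decay

/-! ## §3 The two lattice engines of the tree, volume-uniform for placed index sets -/

section Lattice

variable {d : ℕ} [Fintype Λ] [Fintype Λ']

omit [Fintype Λ'] in
/-- **ℤᵈ, SUP DISTANCE** (`B6KernelComposition.sum_exp_dist_le` BY NAME): for `pos : Λ → ℤᵈ` with fibres `≤ m` and
`a > 0`, `Σ_b e^{−a·dist(x, pos b)} ≤ m·latticeConst d a` for EVERY `x ∈ ℤᵈ` — `latticeConst d a = (2∕(1 − e^{−a∕d}))ᵈ`,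
no `#Λ`. [folklore] -/
theorem sum_exp_dist_comp_le (pos : Λ → (Fin d → ℤ)) {m : ℕ}
    (hm : ∀ x, (Finset.univ.filter fun b => pos b = x).card ≤ m) {a : ℝ} (ha : 0 < a) (x : Fin d → ℤ) :
    ∑ b, Real.exp (-(a * dist x (pos b))) ≤ m * latticeConst d a := by
  classical
  refine (sum_comp_le_card_mul_sum pos (Finset.univ.image pos)
    (fun b => Finset.mem_image_of_mem _ (Finset.mem_univ b)) hm (fun z => Real.exp (-(a * dist x z)))
    fun z => (Real.exp_pos _).le).trans ?_
  exact mul_le_mul_of_nonneg_left (sum_exp_dist_le _ x ha) (Nat.cast_nonneg m)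

variable {T : ℕ} [NeZero T]

omit [Fintype Λ'] in
/-- **THE TORUS `(ℤ∕Tℤ)ᵈ`, PERIODIC ℓ¹ DISTANCE** (`B12Decay510Torus.sum_exp_pl1_le_K₁` BY NAME, translated by `x`):
for `pos : Λ → (ℤ∕Tℤ)ᵈ` with fibres `≤ m` and `a > 0`, `Σ_b e^{−a·pl1(x − pos b)} ≤ m·K₁ d a` for EVERY site `x`,
uniformly in `T` (`K₁ d a = Σ_{z ∈ ℤᵈ} e^{−a|z|₁}`; `K₁ d a ≤ latticeConst d a` for `d ≥ 1` is
`NE9KernelGeometryTorus.K₁_le_c0`). [folklore] -/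
theorem sum_exp_pl1_comp_le (pos : Λ → TPt d T) {m : ℕ} (hm : ∀ x, (Finset.univ.filter fun b => pos b = x).card ≤ m)
    {a : ℝ} (ha : 0 < a) (x : TPt d T) : ∑ b, Real.exp (-(a * pl1 (x - pos b))) ≤ m * K₁ d a := by
  classical
  refine (sum_comp_le_card_mul_sum pos Finset.univ (fun b => Finset.mem_univ _) hm
    (fun y => Real.exp (-(a * pl1 (x - y)))) fun y => (Real.exp_pos _).le).trans ?_
  refine mul_le_mul_of_nonneg_left ?_ (Nat.cast_nonneg m)
  calc ∑ y, Real.exp (-(a * pl1 (x - y))) = ∑ w : TPt d T, Real.exp (-a * pl1 w) := by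
        refine Fintype.sum_equiv (Equiv.subLeft x) _ _ fun y => ?_
        rw [neg_mul]
        rfl
    _ ≤ K₁ d a := sum_exp_pl1_le_K₁ ha

omit [Fintype Λ'] in
/-- The same with the arguments of `pl1` swapped (`pl1 (pos b − x)`; `pl1` is symmetric). [folklore] -/
theorem sum_exp_pl1_comp_le' (pos : Λ → TPt d T) {m : ℕ} (hm : ∀ x, (Finset.univ.filter fun b => pos b = x).card ≤ m)
    {a : ℝ} (ha : 0 < a) (x : TPt d T) : ∑ b, Real.exp (-(a * pl1 (pos b - x))) ≤ m * K₁ d a := by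
  simp_rw [pl1_sub_comm (pos _) x]
  exact sum_exp_pl1_comp_le pos hm ha x

omit [Fintype Λ'] in
/-- **DECAY ON THE TORUS ⇒ ROW SUMS, VOLUME-FREE**: `‖k c b‖ ≤ c₀·e^{−δ·pl1(posOut c − posIn b)}`, `δ > 0`, at most `m`
input indices per site ⟹ `Σ_b ‖k c b‖ ≤ c₀·m·K₁ d δ` for every `c`. [folklore] -/
theorem rowSum_le_of_decay_torus (k : Λ' → Λ → (𝔄 →L[𝕜] 𝔅)) (posIn : Λ → TPt d T) (posOut : Λ' → TPt d T)
    {c₀ δ : ℝ} (hc₀ : 0 ≤ c₀) (hδ : 0 < δ) {m : ℕ} (hm : ∀ x, (Finset.univ.filter fun b => posIn b = x).card ≤ m)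
    (hk : ∀ c b, ‖k c b‖ ≤ c₀ * Real.exp (-(δ * pl1 (posOut c - posIn b)))) (c : Λ') :
    ∑ b, ‖k c b‖ ≤ c₀ * (m * K₁ d δ) :=
  rowSum_le_of_decay k (fun x y => pl1 (x - y)) posIn posOut hc₀ hk (fun x => sum_exp_pl1_comp_le posIn hm hδ x) c

omit [Fintype Λ] in
/-- **DECAY ON THE TORUS ⇒ COLUMN SUMS, VOLUME-FREE**: at most `m′` output indices per site ⟹
`Σ_c ‖k c b‖ ≤ c₀·m′·K₁ d δ` for every `b`. [folklore] -/
theorem colSum_le_of_decay_torus (k : Λ' → Λ → (𝔄 →L[𝕜] 𝔅)) (posIn : Λ → TPt d T) (posOut : Λ' → TPt d T)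
    {c₀ δ : ℝ} (hc₀ : 0 ≤ c₀) (hδ : 0 < δ) {m' : ℕ} (hm' : ∀ x, (Finset.univ.filter fun c => posOut c = x).card ≤ m')
    (hk : ∀ c b, ‖k c b‖ ≤ c₀ * Real.exp (-(δ * pl1 (posOut c - posIn b)))) (b : Λ) :
    ∑ c, ‖k c b‖ ≤ c₀ * (m' * K₁ d δ) :=
  colSum_le_of_decay k (fun x y => pl1 (x - y)) posIn posOut hc₀ hk (fun x => sum_exp_pl1_comp_le' posOut hm' hδ x) b

omit [Fintype Λ'] in
/-- **DECAY ON ℤᵈ ⇒ ROW SUMS, VOLUME-FREE** (sup distance): `Σ_b ‖k c b‖ ≤ c₀·m·latticeConst d δ`. [folklore] -/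
theorem rowSum_le_of_decay_lattice (k : Λ' → Λ → (𝔄 →L[𝕜] 𝔅)) (posIn : Λ → (Fin d → ℤ))
    (posOut : Λ' → (Fin d → ℤ)) {c₀ δ : ℝ} (hc₀ : 0 ≤ c₀) (hδ : 0 < δ) {m : ℕ}
    (hm : ∀ x, (Finset.univ.filter fun b => posIn b = x).card ≤ m)
    (hk : ∀ c b, ‖k c b‖ ≤ c₀ * Real.exp (-(δ * dist (posOut c) (posIn b)))) (c : Λ') :
    ∑ b, ‖k c b‖ ≤ c₀ * (m * latticeConst d δ) :=
  rowSum_le_of_decay k dist posIn posOut hc₀ hk (fun x => sum_exp_dist_comp_le posIn hm hδ x) c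

omit [Fintype Λ] in
/-- **DECAY ON ℤᵈ ⇒ COLUMN SUMS, VOLUME-FREE** (sup distance): `Σ_c ‖k c b‖ ≤ c₀·m′·latticeConst d δ`. [folklore] -/
theorem colSum_le_of_decay_lattice (k : Λ' → Λ → (𝔄 →L[𝕜] 𝔅)) (posIn : Λ → (Fin d → ℤ))
    (posOut : Λ' → (Fin d → ℤ)) {c₀ δ : ℝ} (hc₀ : 0 ≤ c₀) (hδ : 0 < δ) {m' : ℕ}
    (hm' : ∀ x, (Finset.univ.filter fun c => posOut c = x).card ≤ m')
    (hk : ∀ c b, ‖k c b‖ ≤ c₀ * Real.exp (-(δ * dist (posOut c) (posIn b)))) (b : Λ) :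
    ∑ c, ‖k c b‖ ≤ c₀ * (m' * latticeConst d δ) :=
  colSum_le_of_decay k dist posIn posOut hc₀ hk
    (fun x => by
      simp_rw [dist_comm (posOut _) x]
      exact sum_exp_dist_comp_le posOut hm' hδ x) b

end Lattice


end Summit.QuantumFields.BalabanUV.T4Continuum.ShellMeasureDecayKernelSums

end
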